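import Summits.AtomisticToContinuum.FouriersLaw.Theorems.BondHeatUncertaintyBoundedResponseBathHeatSeparationA
import HarnessLib

/-!
# BondHeatUncertainty / BoundedResponse — «Separation» §1b–§2: the level as a DIAL (Lipschitz, convex, level `0` = negative part), ★★★ the LEVEL
FORMULA `𝔇_T(g) = ⨅_L 𝔙_T(L, g)` for EVEN profiles, and the chain facts (part 2 of 3 — overview in the main file `…BathHeatSeparation`; imports part A)

§1b `levelViolation_le_add_mul` (`𝔙_T(L,g) ≤ 𝔙_T(L',g) + |L−L'|·∫|θ_T|dν_T`); `levelViolation_convexOn` (convex in `L`: a 1-D convex programme, bisection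
from a kick table); `levelViolation_zero_eq` (`𝔙_T(0,g) = ∫(θ_T g)⁻ dν_T`); ★★ `levelViolation_le_integral_of_cross` (even `g`, admissible `R` crossing
`a + b·k`: `𝔙_T(a,g) ≤ ∫|θ_T||g − R|` — flip-symmetrise `R`, the slope cancels, compare with the clip pointwise); ★★★
`thermalCrossDefect_eq_iInf_levelViolation`; `exists_levelViolation_lt`; `integral_sqSub_mul_ge_neg_levelViolation` (`∫θ_T g ≥ −𝔙_T(L,g)`).
§2 the three 1-D facts (even · measurable · `θ_T·(·) ∈ L¹`) for NODE 111's `heatReturnProfile` and NODE 110's `kinKickProfile`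
(`heatReturnProfile_levelFacts`, `kinKickProfile_levelFacts`); ★★ `heatReturnDefect_eq_iInf_levelViolation`, `kinResponseDefect_eq_iInf_levelViolation`
(both defects of the lineage are ONE-PARAMETER level minimisations of explicit integrals); ★ `bathTailLate_ge_neg_levelViolation`
(`B^late_N(s,t) ≥ −γ²·𝔙_T(L, 𝔊^{s,t}_N)` for every level). No `sorry`, no new axioms; nothing here is a route statement.
-/

noncomputable section

open MeasureTheory ProbabilityTheory Filter Topology Set Function
open scoped NNReal ENNReal
open Literature.MathematicalPhysics.KineticTheory.HeatConduction
open Literature.MathematicalPhysics.KineticTheory OscillatorChain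
open Literature.Probability.Process

namespace Summit.AtomisticToContinuum.FouriersLaw.Theorems.BoundedResponse.HeatSpreading

/-! ## §1b (NODE 114) The level as a dial: Lipschitz, convex, level `0`; ★★★ the LEVEL FORMULA `𝔇_T = ⨅_L 𝔙_T(L,·)` for even profiles -/

section OneDimLevelB

variable {T : ℝ}

/-- ★ **`𝔙` IS LIPSCHITZ IN THE LEVEL**: `𝔙_T(L, g) ≤ 𝔙_T(L', g) + |L − L'|·∫|θ_T| dν_T` — levels within `O(B)` of each other are interchangeable at
budget `O(B)`. [this cell] -/
theorem levelViolation_le_add_mul {g : ℝ → ℝ} (hgm : Measurable g)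
    (hg : Integrable (fun k : ℝ => (k ^ 2 - T) * g k) (gaussianReal 0 T.toNNReal)) (L L' : ℝ) :
    levelViolation T L g ≤ levelViolation T L' g + |L - L'| * ∫ k, |k ^ 2 - T| ∂(gaussianReal 0 T.toNNReal) := by
  rw [levelViolation_eq_integral hgm hg L, levelViolation_eq_integral hgm hg L', ← integral_const_mul, ← integral_add]
  rotate_left
  · obtain ⟨h1, h2⟩ := integrable_hotCold_integrands hgm hg L'
    exact h1.add h2
  · exact (gaussT_integrable_sqSub T).abs.const_mul _
  refine integral_mono ?_ ?_ fun k => ?_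
  · obtain ⟨h1, h2⟩ := integrable_hotCold_integrands hgm hg L
    exact h1.add h2
  · obtain ⟨h1, h2⟩ := integrable_hotCold_integrands hgm hg L'
    exact (h1.add h2).add ((gaussT_integrable_sqSub T).abs.const_mul _)
  have hb1 : max (L - g k) 0 ≤ max (L' - g k) 0 + |L - L'| :=
    max_le (by linarith [le_max_left (L' - g k) 0, le_abs_self (L - L')]) (by positivity)
  have hb2 : max (g k - L) 0 ≤ max (g k - L') 0 + |L - L'| :=
    max_le (by linarith [le_max_left (g k - L') 0, neg_abs_le (L - L')]) (by positivity)
  have hθabs : max (k ^ 2 - T) 0 + max (T - k ^ 2) 0 = |k ^ 2 - T| := by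
    rw [show T - k ^ 2 = -(k ^ 2 - T) by ring]; exact max_zero_add_max_neg_zero _
  have e : max (k ^ 2 - T) 0 * (max (L' - g k) 0 + |L - L'|) + max (T - k ^ 2) 0 * (max (g k - L') 0 + |L - L'|) =
      max (k ^ 2 - T) 0 * max (L' - g k) 0 + max (T - k ^ 2) 0 * max (g k - L') 0 + |L - L'| * |k ^ 2 - T| := by
    rw [← hθabs]; ring
  calc max (k ^ 2 - T) 0 * max (L - g k) 0 + max (T - k ^ 2) 0 * max (g k - L) 0
      ≤ max (k ^ 2 - T) 0 * (max (L' - g k) 0 + |L - L'|) + max (T - k ^ 2) 0 * (max (g k - L') 0 + |L - L'|) :=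
        add_le_add (mul_le_mul_of_nonneg_left hb1 (le_max_right _ _)) (mul_le_mul_of_nonneg_left hb2 (le_max_right _ _))
    _ = _ := e

/-- ★ **`L ↦ 𝔙_T(L, g)` IS CONVEX** (pointwise: `L ↦ (L − g)⁺`, `L ↦ (g − L)⁺` are convex and the weights are `≥ 0`): the level
minimisation behind the defect is a one-dimensional CONVEX programme — INSTRUMENTABLE from a kick table by bisection. [this cell] -/
theorem levelViolation_convexOn {g : ℝ → ℝ} (hgm : Measurable g)
    (hg : Integrable (fun k : ℝ => (k ^ 2 - T) * g k) (gaussianReal 0 T.toNNReal)) :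
    ConvexOn ℝ Set.univ (fun L : ℝ => levelViolation T L g) := by
  refine ⟨convex_univ, fun L₁ _ L₂ _ p q hp hq hpq => ?_⟩
  simp only [smul_eq_mul]
  obtain ⟨h1, h2⟩ := integrable_hotCold_integrands hgm hg (p * L₁ + q * L₂)
  obtain ⟨h1a, h2a⟩ := integrable_hotCold_integrands hgm hg L₁
  obtain ⟨h1b, h2b⟩ := integrable_hotCold_integrands hgm hg L₂
  have hIa : Integrable (fun k : ℝ => p * (max (k ^ 2 - T) 0 * max (L₁ - g k) 0 + max (T - k ^ 2) 0 * max (g k - L₁) 0))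
      (gaussianReal 0 T.toNNReal) := (h1a.add h2a).const_mul p
  have hIb : Integrable (fun k : ℝ => q * (max (k ^ 2 - T) 0 * max (L₂ - g k) 0 + max (T - k ^ 2) 0 * max (g k - L₂) 0))
      (gaussianReal 0 T.toNNReal) := (h1b.add h2b).const_mul q
  rw [levelViolation_eq_integral hgm hg, levelViolation_eq_integral hgm hg L₁, levelViolation_eq_integral hgm hg L₂,
    ← integral_const_mul, ← integral_const_mul, ← integral_add hIa hIb]
  refine integral_mono (h1.add h2) (hIa.add hIb) fun k => ?_
  have hA : 0 ≤ max (k ^ 2 - T) 0 := le_max_right _ _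
  have hB : 0 ≤ max (T - k ^ 2) 0 := le_max_right _ _
  have e1 : p * L₁ + q * L₂ - g k = p * (L₁ - g k) + q * (L₂ - g k) := by linear_combination (g k) * hpq
  have e2 : g k - (p * L₁ + q * L₂) = p * (g k - L₁) + q * (g k - L₂) := by linear_combination (-(g k)) * hpq
  have hm1 : max (p * L₁ + q * L₂ - g k) 0 ≤ p * max (L₁ - g k) 0 + q * max (L₂ - g k) 0 := by
    rw [e1]
    exact max_le (add_le_add (mul_le_mul_of_nonneg_left (le_max_left _ _) hp) (mul_le_mul_of_nonneg_left (le_max_left _ _) hq))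
      (add_nonneg (mul_nonneg hp (le_max_right _ _)) (mul_nonneg hq (le_max_right _ _)))
  have hm2 : max (g k - (p * L₁ + q * L₂)) 0 ≤ p * max (g k - L₁) 0 + q * max (g k - L₂) 0 := by
    rw [e2]
    exact max_le (add_le_add (mul_le_mul_of_nonneg_left (le_max_left _ _) hp) (mul_le_mul_of_nonneg_left (le_max_left _ _) hq))
      (add_nonneg (mul_nonneg hp (le_max_right _ _)) (mul_nonneg hq (le_max_right _ _)))
  calc max (k ^ 2 - T) 0 * max (p * L₁ + q * L₂ - g k) 0 + max (T - k ^ 2) 0 * max (g k - (p * L₁ + q * L₂)) 0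
      ≤ max (k ^ 2 - T) 0 * (p * max (L₁ - g k) 0 + q * max (L₂ - g k) 0) +
          max (T - k ^ 2) 0 * (p * max (g k - L₁) 0 + q * max (g k - L₂) 0) :=
        add_le_add (mul_le_mul_of_nonneg_left hm1 hA) (mul_le_mul_of_nonneg_left hm2 hB)
    _ = p * (max (k ^ 2 - T) 0 * max (L₁ - g k) 0 + max (T - k ^ 2) 0 * max (g k - L₁) 0) +
          q * (max (k ^ 2 - T) 0 * max (L₂ - g k) 0 + max (T - k ^ 2) 0 * max (g k - L₂) 0) := by ring

/-- ★ **LEVEL `0`**: `𝔙_T(0, g) = ∫ (θ_T·g)⁻ dν_T` — the negative part of the integrand of `∫ θ_T·g dν_T` (so `∫ θ_T g ≥ −𝔙_T(0,g)` is the trivial floor,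
and the level is the dial that improves on it). [this cell] -/
theorem levelViolation_zero_eq {g : ℝ → ℝ} (hgm : Measurable g)
    (hg : Integrable (fun k : ℝ => (k ^ 2 - T) * g k) (gaussianReal 0 T.toNNReal)) :
    levelViolation T 0 g = ∫ k, max (-((k ^ 2 - T) * g k)) 0 ∂(gaussianReal 0 T.toNNReal) := by
  rw [levelViolation_eq_integral hgm hg 0]
  exact integral_congr_ae (ae_of_all _ fun k => hotCold_integrand_zero_eq T g k)

/-- ★★ **EVEN PROFILES: the violation at the crossing level is below the distance to ANY admissible comparison curve** — for `g` even with
`θ_T g ∈ L¹`, and `R` crossing the affine function `a + b·k` at `±√T` with `θ_T R ∈ L¹`: `𝔙_T(a, g) ≤ ∫ |θ_T|·|g − R| dν_T`.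
Proof: flip-symmetrise `R` (`ν_T`, `θ_T`, `g` are even; the slope `b` cancels), then compare pointwise with the clip. [this cell] -/
theorem levelViolation_le_integral_of_cross {g : ℝ → ℝ} (hge : ∀ k : ℝ, g (-k) = g k) (hgm : Measurable g)
    (hg : Integrable (fun k : ℝ => (k ^ 2 - T) * g k) (gaussianReal 0 T.toNNReal))
    {R : ℝ → ℝ} {a b : ℝ} (hcross : ∀ k : ℝ, 0 ≤ (k ^ 2 - T) * (R k - (a + b * k)))
    (hR : Integrable (fun k : ℝ => (k ^ 2 - T) * R k) (gaussianReal 0 T.toNNReal)) :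
    levelViolation T a g ≤ ∫ k, |k ^ 2 - T| * |g k - R k| ∂(gaussianReal 0 T.toNNReal) := by
  set ν := gaussianReal 0 T.toNNReal with hν
  set F : ℝ → ℝ := fun k => (k ^ 2 - T) * g k with hF
  set G : ℝ → ℝ := fun k => (k ^ 2 - T) * R k with hG
  have hneg : MeasurePreserving (fun k : ℝ => -k) ν ν := gaussT_measurePreserving_neg T
  have hG' : Integrable (fun k => G (-k)) ν := (hneg.integrable_comp hR.aestronglyMeasurable).2 hR
  -- the distance in terms of `F − G`, and its flip
  have hdist : ∀ k, |k ^ 2 - T| * |g k - R k| = |F k - G k| := fun k => by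
    simp only [hF, hG, ← abs_mul, mul_sub]
  have hflip : ∫ k, |F k - G (-k)| ∂ν = ∫ k, |F k - G k| ∂ν := by
    have h := hneg.integral_comp (MeasurableEquiv.neg ℝ).measurableEmbedding (fun y => |F y - G y|)
    have hFe : ∀ k, F (-k) = F k := fun k => by simp only [hF, neg_sq, hge]
    simp_rw [hFe] at h
    exact h
  -- pointwise: violation integrand ≤ |F − (G + G∘flip)/2| ≤ (|F − G| + |F − G∘flip|)/2
  have hpt : ∀ k : ℝ, max (k ^ 2 - T) 0 * max (a - g k) 0 + max (T - k ^ 2) 0 * max (g k - a) 0 ≤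
      |F k - (G k + G (-k)) / 2| := by
    intro k
    have h1 := hcross k
    have h2 := hcross (-k)
    simp only [neg_sq, mul_neg] at h2
    have hRs : 0 ≤ (k ^ 2 - T) * ((R k + R (-k)) / 2 - a) := by nlinarith
    have e : F k - (G k + G (-k)) / 2 = (k ^ 2 - T) * (g k - (R k + R (-k)) / 2) := by
      simp only [hF, hG, neg_sq]; ring
    rw [e, abs_mul]
    rcases lt_trichotomy T (k ^ 2) with hlt | heq | hgt
    · have hθ : 0 < k ^ 2 - T := by linarith
      have hRa : a ≤ (R k + R (-k)) / 2 := by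
        by_contra hcon
        push Not at hcon
        nlinarith
      rw [max_eq_left hθ.le, max_eq_right (by linarith : T - k ^ 2 ≤ 0), zero_mul, add_zero, abs_of_pos hθ]
      refine mul_le_mul_of_nonneg_left ?_ hθ.le
      rcases le_total (g k) a with hga | hga
      · rw [max_eq_left (by linarith : 0 ≤ a - g k), abs_sub_comm]
        exact le_trans (by linarith) (le_abs_self _)
      · rw [max_eq_right (by linarith : a - g k ≤ 0)]
        exact abs_nonneg _
    · rw [← heq]
      simp
    · have hθ : k ^ 2 - T < 0 := by linarith
      have hRa : (R k + R (-k)) / 2 ≤ a := by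
        by_contra hcon
        push Not at hcon
        nlinarith
      rw [max_eq_right hθ.le, max_eq_left (by linarith : 0 ≤ T - k ^ 2), zero_mul, zero_add, abs_of_neg hθ,
        show -(k ^ 2 - T) = T - k ^ 2 by ring]
      refine mul_le_mul_of_nonneg_left ?_ (by linarith)
      rcases le_total a (g k) with hga | hga
      · rw [max_eq_left (by linarith : 0 ≤ g k - a)]
        exact le_trans (by linarith) (le_abs_self _)
      · rw [max_eq_right (by linarith : g k - a ≤ 0)]
        exact abs_nonneg _
  have hpt2 : ∀ k : ℝ, |F k - (G k + G (-k)) / 2| ≤ (|F k - G k| + |F k - G (-k)|) / 2 := by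
    intro k
    rw [show F k - (G k + G (-k)) / 2 = ((F k - G k) + (F k - G (-k))) / 2 by ring, abs_div, abs_two]
    exact div_le_div_of_nonneg_right (abs_add_le _ _) zero_le_two
  -- integrate
  obtain ⟨hI1, hI2⟩ := integrable_hotCold_integrands hgm hg a
  have hIm : Integrable (fun k => |F k - (G k + G (-k)) / 2|) ν := (hg.sub ((hR.add hG').div_const 2)).abs
  have hA : Integrable (fun k => |F k - G k|) ν := (hg.sub hR).abs
  have hB : Integrable (fun k => |F k - G (-k)|) ν := (hg.sub hG').abs
  have hIr : Integrable (fun k => (|F k - G k| + |F k - G (-k)|) / 2) ν := (hA.add hB).div_const 2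
  calc levelViolation T a g
      = ∫ k, (max (k ^ 2 - T) 0 * max (a - g k) 0 + max (T - k ^ 2) 0 * max (g k - a) 0) ∂ν :=
        levelViolation_eq_integral hgm hg a
    _ ≤ ∫ k, |F k - (G k + G (-k)) / 2| ∂ν := integral_mono (hI1.add hI2) hIm hpt
    _ ≤ ∫ k, (|F k - G k| + |F k - G (-k)|) / 2 ∂ν := integral_mono hIm hIr hpt2
    _ = ((∫ k, |F k - G k| ∂ν) + ∫ k, |F k - G (-k)| ∂ν) / 2 := by
        rw [integral_div, integral_add hA hB]
    _ = ∫ k, |F k - G k| ∂ν := by rw [hflip]; ring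
    _ = ∫ k, |k ^ 2 - T| * |g k - R k| ∂ν := integral_congr_ae (ae_of_all _ fun k => (hdist k).symm)

/-- The range of `L ↦ 𝔙_T(L, g)` is bounded below by `0`. [formal bookkeeping] -/
theorem bddBelow_range_levelViolation (T : ℝ) (g : ℝ → ℝ) : BddBelow (Set.range fun L : ℝ => levelViolation T L g) :=
  ⟨0, by rintro _ ⟨L, rfl⟩; exact levelViolation_nonneg T L g⟩

/-- ★★★ **THE LEVEL FORMULA**: for an EVEN profile `g` (measurable, `θ_T g ∈ L¹(ν_T)`), NODE 110's crossing defect is EXACTLY the least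
level-separation violation: `𝔇_T(g) = ⨅_L 𝔙_T(L, g)`. The cone of single-crossing comparison curves is resolved by level clipping; the defect
floors of NODES 110/111 (`𝔇_T ≤ …`) are SEPARATION statements. [this cell] -/
theorem thermalCrossDefect_eq_iInf_levelViolation {g : ℝ → ℝ} (hge : ∀ k : ℝ, g (-k) = g k) (hgm : Measurable g)
    (hg : Integrable (fun k : ℝ => (k ^ 2 - T) * g k) (gaussianReal 0 T.toNNReal)) :
    thermalCrossDefect T g = ⨅ L : ℝ, levelViolation T L g := by
  apply le_antisymm
  · exact le_ciInf fun L => thermalCrossDefect_le_levelViolation hgm hg L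
  · unfold thermalCrossDefect
    refine le_csInf ((Set.image_nonempty).2 ⟨_, thermalCross_zero_mem T⟩) ?_
    rintro d ⟨R, ⟨⟨a, b, hcross⟩, hR⟩, rfl⟩
    exact (ciInf_le (bddBelow_range_levelViolation T g) a).trans
      (levelViolation_le_integral_of_cross hge hgm hg hcross hR)

/-- ★ Near-optimal levels exist: `∀ ε > 0 ∃ L, 𝔙_T(L, g) < 𝔇_T(g) + ε` (even `g`). [this cell] -/
theorem exists_levelViolation_lt {g : ℝ → ℝ} (hge : ∀ k : ℝ, g (-k) = g k) (hgm : Measurable g)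
    (hg : Integrable (fun k : ℝ => (k ^ 2 - T) * g k) (gaussianReal 0 T.toNNReal)) {ε : ℝ} (hε : 0 < ε) :
    ∃ L : ℝ, levelViolation T L g < thermalCrossDefect T g + ε :=
  exists_lt_of_ciInf_lt (by rw [← thermalCrossDefect_eq_iInf_levelViolation hge hgm hg]; linarith)

/-- ★ **`∫ θ_T·g dν_T ≥ −𝔙_T(L, g)` for every level** (the floor through the level bound). [this cell] -/
theorem integral_sqSub_mul_ge_neg_levelViolation (hT : 0 ≤ T) {g : ℝ → ℝ} (hgm : Measurable g)
    (hg : Integrable (fun k : ℝ => (k ^ 2 - T) * g k) (gaussianReal 0 T.toNNReal)) (L : ℝ) :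
    -levelViolation T L g ≤ ∫ k, (k ^ 2 - T) * g k ∂(gaussianReal 0 T.toNNReal) :=
  le_trans (neg_le_neg (thermalCrossDefect_le_levelViolation hgm hg L)) (integral_sqSub_mul_ge_neg_thermalCrossDefect hT hg)

end OneDimLevelB

/-! ## §2 (NODE 114) The chain: the level formula for NODE 110/111's response curves; the late bath tail floored by every level -/

section ChainFacts

variable {ω₂ lam β γ : ℝ} {T : ℝ}

/-- The three 1-D facts the level formula needs, for NODE 111's heat-return curve `𝔊^{s,t}_{n+1}` (`s, t ≥ 0`): EVEN, measurable,
`θ_T·𝔊 ∈ L¹(ν_T)`. [formal bookkeeping] -/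
theorem heatReturnProfile_levelFacts (hω : 0 < ω₂) (hl : 0 < lam) (hβ : 0 < β) (hγ : 0 < γ) (hT : 0 < T) (n : ℕ)
    {s t : ℝ} (hs : 0 ≤ s) (ht : 0 ≤ t) :
    (∀ k : ℝ, heatReturnProfile ω₂ lam β γ T (n + 1) s t (-k) = heatReturnProfile ω₂ lam β γ T (n + 1) s t k) ∧
      Measurable (heatReturnProfile ω₂ lam β γ T (n + 1) s t) ∧
      Integrable (fun k : ℝ => (k ^ 2 - T) * heatReturnProfile ω₂ lam β γ T (n + 1) s t k) (gaussianReal 0 T.toNNReal) := by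
  refine ⟨fun k => heatReturnProfile_neg hω hl.le hβ.le hγ.le T (n + 1) s t k, ?_,
    (bathTailLate_eq_integral_heatReturnProfile hω hl hβ hγ hT n hs ht).1⟩
  rw [heatReturnProfile_succ]
  exact (stronglyMeasurable_kickAvg hω hl.le hβ.le γ hT n
    (stronglyMeasurable_lateCumFcast hω hl.le hβ.le hγ.le T n s t).measurable).measurable

/-- The same three facts for NODE 110's energy-response curve `Ḡ_{n+1,u}`. [formal bookkeeping] -/
theorem kinKickProfile_levelFacts (hω : 0 < ω₂) (hl : 0 < lam) (hβ : 0 < β) (hγ : 0 < γ) (hT : 0 < T) (n : ℕ) (u : ℝ) :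
    (∀ k : ℝ, kinKickProfile ω₂ lam β γ T (n + 1) u (-k) = kinKickProfile ω₂ lam β γ T (n + 1) u k) ∧
      Measurable (kinKickProfile ω₂ lam β γ T (n + 1) u) ∧
      Integrable (fun k : ℝ => (k ^ 2 - T) * kinKickProfile ω₂ lam β γ T (n + 1) u k) (gaussianReal 0 T.toNNReal) := by
  refine ⟨fun k => (kickProfiles_neg hω hl.le hβ.le hγ.le T (n + 1) u k).1, ?_,
    (bathKinCorr_eq_integral_kinKickProfile hω hl hβ hγ hT n u).1⟩
  rw [kinKickProfile_succ]
  exact (stronglyMeasurable_kickAvg hω hl.le hβ.le γ hT n (measurable_kinFcastG ω₂ lam β γ T n u.toNNReal)).measurable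

/-- ★★ **NODE 111's HEAT-RETURN DEFECT IS A LEVEL MINIMISATION**: `𝔇_T(𝔊^{s,t}_N) = ⨅_L 𝔙_T(L, 𝔊^{s,t}_N)` (`N ≥ 1`, `s,t ≥ 0`). [this cell] -/
theorem heatReturnDefect_eq_iInf_levelViolation (hω : 0 < ω₂) (hl : 0 < lam) (hβ : 0 < β) (hγ : 0 < γ) (hT : 0 < T) (n : ℕ)
    {s t : ℝ} (hs : 0 ≤ s) (ht : 0 ≤ t) :
    thermalCrossDefect T (heatReturnProfile ω₂ lam β γ T (n + 1) s t) =
      ⨅ L : ℝ, levelViolation T L (heatReturnProfile ω₂ lam β γ T (n + 1) s t) := by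
  obtain ⟨he, hm, hI⟩ := heatReturnProfile_levelFacts hω hl hβ hγ hT n hs ht
  exact thermalCrossDefect_eq_iInf_levelViolation he hm hI

/-- ★★ **NODE 110's RESPONSE DEFECT IS A LEVEL MINIMISATION**: `𝔇_N(u) = ⨅_L 𝔙_T(L, Ḡ_{N,u})` (`N ≥ 1`). [this cell] -/
theorem kinResponseDefect_eq_iInf_levelViolation (hω : 0 < ω₂) (hl : 0 < lam) (hβ : 0 < β) (hγ : 0 < γ) (hT : 0 < T)
    (n : ℕ) (u : ℝ) :
    kinResponseDefect ω₂ lam β γ T (n + 1) u = ⨅ L : ℝ, levelViolation T L (kinKickProfile ω₂ lam β γ T (n + 1) u) := by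
  obtain ⟨he, hm, hI⟩ := kinKickProfile_levelFacts hω hl hβ hγ hT n u
  exact thermalCrossDefect_eq_iInf_levelViolation he hm hI

/-- ★ **THE LATE BATH TAIL IS FLOORED BY EVERY LEVEL VIOLATION**: `B^{late}_N(s,t) ≥ −γ²·𝔙_T(L, 𝔊^{s,t}_N)` for every `L`. [this cell] -/
theorem bathTailLate_ge_neg_levelViolation (hω : 0 < ω₂) (hl : 0 < lam) (hβ : 0 < β) (hγ : 0 < γ) (hT : 0 < T) (n : ℕ)
    {s t : ℝ} (hs : 0 ≤ s) (ht : 0 ≤ t) (L : ℝ) :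
    -(γ ^ 2 * levelViolation T L (heatReturnProfile ω₂ lam β γ T (n + 1) s t)) ≤ bathTailLate ω₂ lam β γ T (n + 1) s t := by
  obtain ⟨hI, e⟩ := bathTailLate_eq_integral_heatReturnProfile hω hl hβ hγ hT n hs ht
  obtain ⟨-, hm, -⟩ := heatReturnProfile_levelFacts hω hl hβ hγ hT n hs ht
  rw [e, neg_mul_eq_mul_neg]
  exact mul_le_mul_of_nonneg_left (integral_sqSub_mul_ge_neg_levelViolation hT.le hm hI L) (sq_nonneg γ)

end ChainFacts

end Summit.AtomisticToContinuum.FouriersLaw.Theorems.BoundedResponse.HeatSpreading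

end
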